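import Mathlib.NumberTheory.ArithmeticFunction.Moebius
import Mathlib.NumberTheory.ArithmeticFunction.Liouville
import Mathlib.Analysis.SpecialFunctions.Pow.Real
import Mathlib.Order.Filter.AtTopBot.Basic
import Literature.Computability.Complexity.ConstantDepth
import Literature.Computability.Complexity.BoolEncodings
import Literature.Computability.Complexity.BooleanFourier
import HarnessLib

/-!
# Möbius / Liouville versus bounded-depth circuits and Walsh functions (Green 2012; Bourgain 2013)

Named facts (D-0014: `def … : Prop`, users take `(h : Fact)`), vendored AS PRINTED, for the two
results at the base of every "Möbius randomness versus small circuit classes" ladder: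

* B. Green, *On (not) computing the Möbius function using bounded depth circuits*, Combin.
  Probab. Comput. 21 (2012) 942–951 [Green2012] (= arXiv:1103.4991), §1:
  - **Theorem 1** (`Green2012_moebius_boundedDepth`): `N = 2^n`; if `F : {0,…,N-1} → {-1,1}` is
    an `AC⁰(d)` function — computed from the `n` binary digits of `x` by a circuit of unbounded
    fan-in `AND`/`OR` gates and `NOT` gates of depth `≤ d` and size `≤ n^d` — then
    `E_{0 ≤ x ≤ N-1} μ(x) F(x) = O(e^{d log n - c n^{1/6d}})`, `c > 0` absolute;
  - **Proposition 1** (`Green2012_moebius_walshCoeff`): for `S ⊆ {1,…,n}` with `|S| = k`,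
    `μ̂(S) := E_{0 ≤ x ≤ N-1} μ(x) (-1)^{∑_{i ∈ S} x_i} = O(k e^{-c n^{1/2}/k})`;
  - the printed remark (§1, p. 3 of the arXiv version): "All of the results in this paper hold
    equally well for the Liouville function, with very similar proofs" — recorded as the `λ`
    twins `Green2012_liouville_boundedDepth`, `Green2012_liouville_walshCoeff`.
* J. Bourgain, *Möbius–Walsh correlation bounds and an estimate of Mauduit and Rivat*, J. Anal.
  Math. 119 (2013) 147–163 [Bourgain2013MoebiusWalsh] (= arXiv:1109.2784), **Theorem 1**
  (`Bourgain2013_moebius_walsh`): for `λ` large enough,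
  `max_{A ⊆ {0,…,λ-1}} |∑_{n < 2^λ} μ(n) w_A(n)| < 2^{λ - λ^{1/10}}`, where
  `w_A(x) = ∏_{j ∈ A} (1 - 2 x_j)`, `x = ∑_{0 ≤ j < λ} x_j 2^j`; printed parenthesis "(a similar
  estimate is also valid for the Liouville function)" — recorded as `Bourgain2013_liouville_walsh`
  with the saving exponent left free (`2^{λ - λ^c}` for some `c > 0`), the reading the printed
  sentence certainly covers.

## Lean rendering (conventions checked against the sources)

* Digits: a point `x : Fin n → Bool` of the cube is the integer `bitsToNat (List.ofFn x) =
  ∑ᵢ xᵢ 2ⁱ` (least significant digit = index `0`; Green writes `x = x₁ + 2x₂ + ⋯ + 2^{n-1}xₙ`,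
  Bourgain `x = ∑_{0 ≤ j < λ} x_j 2^j`), so `E_{0 ≤ x ≤ N-1}` is `(∑_{x : Fin n → Bool} …) / 2^n`.
  In Bourgain's sum over `n < 2^λ` we index by `N ∈ Finset.range (2^λ)` and read digits with
  `Nat.testBit` (the same bijection). `μ(0) = 0` (Green, §1: "set μ(0) = 0") and `λ(0) = 0` are
  Mathlib's values (`ArithmeticFunction.map_zero`).
* Walsh functions: `(-1)^{∑_{i∈S} xᵢ} = ∏_{i∈S} (1 - 2xᵢ)` is the tree's
  `Literature.Probability.RandomGraphs.LowDegree.walsh S x = ∏_{i∈S} sgn (x i)` (`sgn true = -1`),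
  and Green's `f̂(S)` is the tree's `LowDegree.cubeFourierCoeff (f ∘ val) S = (∑ₓ f(val x) χ_S(x)) / 2^n`.
* Circuits: Green's model (§1: "every node is either an input node … labelled by one of the binary
  digits of x, an AND gate, an OR or a NOT gate. The AND and OR gates are allowed to have arbitrary
  fan-in … The size of a circuit is the total number of gates it contains and its depth is the
  maximal length of a path from an input gate to the output gate. The class AC⁰(d) consists of all
  functions that can be computed using a circuit of depth at most d and size at most n^d") is the
  tree's `Circuit (Fin n)` over `acBasis` with `Circuit.depth` (EVERY gate, negations included,
  counts `1` — Green's depth, not the negation-free `acDepth` of the class `AC0`) and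
  `Circuit.size` (number of gates). The `±1` output is `sgn (K.eval x)`; the opposite sign
  convention changes the correlation by a global sign, immaterial under `|·|`. We require `1 ≤ d`
  (`n^{1/6d}` is not meant at `d = 0`).
* `O(·)` with "absolute constant": one pair of absolute constants `c > 0`, `C`, uniformly in
  `d ≥ 1`, `n` and the circuit (as printed: the implied constant does not depend on `d`, cf. the
  last display of §2 of the paper); small `n` are covered since `|E μ F| ≤ 1`.

## What these facts ground (route items; the items are NOT restated here)

* `Summit.PneNP.PneNP.Theses.Mobius.LiouvilleNotAC0` (stmt-PneNP-1112) and
  `Summit.QuantumAdvantage.QuantumAdvantage.Theses.MobiusLadder.LiouvilleNotAC0`: Green's Theorem 1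
  (λ form) + glue (a family deciding the language of canonical numerals restricts, at length `m`,
  to a circuit whose `±1` output is `λ`-correlated on the codewords = top bit `1`, i.e. on
  `[2^{m-1}, 2^m)`, plus `∑_{x < X} λ(x) = o(X)`; `acDepth ≤ depth`, polynomial size `≤ m^d` for
  `d` large) — the items are NOT mere instantiations.
* `…Mobius.LiouvilleDigitalPhases` (stmt-PneNP-1107), degree-1 case only (a linear phase
  `(-1)^{P(x)}` is `± w_A`): `Bourgain2013_liouville_walsh`; the polylog-degree statement is open.
* `…MobiusLadder.WalshLiouvilleBound` (stmt-QuantumAdvantage-1390) = `Bourgain2013_liouville_walsh`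
  up to `<` versus `≤`.

Deliberately NOT here: Linial–Mansour–Nisan (Green's Thm 2; the tree proves Tal's sharper
`Circuit.l1Level_acBasis_le`, `tailWeight_le_tailBound`), Bourgain's GRH Theorem 2, Bourgain's
Israel J. Math. level-`n^{2/3}` theorem [Bourgain2013Walsh], Mauduit–Rivat.
-/

namespace Literature.Computability.Complexity

open Literature.Probability.RandomGraphs.LowDegree (walsh sgn)
open Literature.Computability.Complexity.LowDegree (cubeFourierCoeff)

/-! ### Green 2012 -/

/-- **Green 2012, Theorem 1** (as printed, for `μ`): "Suppose `N = 2^n`. Let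
`F : {0,…,N-1} → {-1,1}` be an `AC⁰(d)` function [computed from the binary digits of `x` by a
circuit of unbounded fan-in AND/OR gates and NOT gates, depth `≤ d`, size `≤ n^d`]. Then
`E_{0 ≤ x ≤ N-1} μ(x) F(x) = O(e^{d log n - c n^{1/6d}})`, where `c > 0` is an absolute constant."
Lean: absolute `c > 0` and implied constant `C`; for every `d ≥ 1`, `n`, and circuit `K` on
`Fin n` over `acBasis` with `K.depth ≤ d` (all gates count) and `K.size ≤ n ^ d`,
`|(∑ₓ μ(val x) · sgn (K.eval x)) / 2^n| ≤ C · exp (d log n - c n^{1/(6d)})`,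
`val x = bitsToNat (List.ofFn x)`. [cite: Green2012, Theorem 1] -/
def Green2012_moebius_boundedDepth : Prop :=
  ∃ c : ℝ, 0 < c ∧ ∃ C : ℝ, ∀ d : ℕ, 1 ≤ d → ∀ n : ℕ, ∀ K : Circuit (Fin n),
    K.IsOver acBasis → K.depth ≤ d → K.size ≤ n ^ d →
      |(∑ x : Fin n → Bool,
          (ArithmeticFunction.moebius (bitsToNat (List.ofFn x)) : ℝ) * sgn (K.eval x)) / 2 ^ n|
        ≤ C * Real.exp (d * Real.log n - c * (n : ℝ) ^ ((1 : ℝ) / (6 * d)))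

/-- **Green 2012, Theorem 1 for the Liouville function** (printed as the remark of §1: "All of the
results in this paper hold equally well for the Liouville function, with very similar proofs"):
for every `d ≥ 1`, `n`, and circuit `K` on `Fin n` over `acBasis` with `K.depth ≤ d` and
`K.size ≤ n ^ d`, `|(∑ₓ λ(val x) · sgn (K.eval x)) / 2^n| ≤ C · exp (d log n - c n^{1/(6d)})`
with absolute `c > 0`, `C`. This is the fact behind "`L_λ ∉ AC⁰`"
(`Summit.PneNP.PneNP.Theses.Mobius.LiouvilleNotAC0`, after encoding glue).
[cite: Green2012, Theorem 1 and §1 remark (Liouville)] -/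
def Green2012_liouville_boundedDepth : Prop :=
  ∃ c : ℝ, 0 < c ∧ ∃ C : ℝ, ∀ d : ℕ, 1 ≤ d → ∀ n : ℕ, ∀ K : Circuit (Fin n),
    K.IsOver acBasis → K.depth ≤ d → K.size ≤ n ^ d →
      |(∑ x : Fin n → Bool,
          (ArithmeticFunction.liouville (bitsToNat (List.ofFn x)) : ℝ) * sgn (K.eval x)) / 2 ^ n|
        ≤ C * Real.exp (d * Real.log n - c * (n : ℝ) ^ ((1 : ℝ) / (6 * d)))

/-- **Green 2012, Proposition 1** (as printed, for `μ`): "Suppose that `S ⊆ {1,…,n}` has size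
`|S| = k`. Then `μ̂(S) = O(k e^{-c n^{1/2}/k})`, where `c > 0` is some absolute constant"; here
`μ̂(S) := E_{0 ≤ x ≤ N-1} μ(x) (-1)^{∑_{i∈S} x_i}` (Green's Definition, §1) is the tree's
`cubeFourierCoeff (μ ∘ val) S`. Lean: absolute `c > 0`, `C`; for all `n` and all nonempty
`S : Finset (Fin n)` (`k = |S| ≥ 1`; the display is not meant at `k = 0`),
`|μ̂(S)| ≤ C · k · exp (-(c · √n / k))`. [cite: Green2012, Proposition 1] -/
def Green2012_moebius_walshCoeff : Prop :=
  ∃ c : ℝ, 0 < c ∧ ∃ C : ℝ, ∀ n : ℕ, ∀ S : Finset (Fin n), 1 ≤ S.card →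
    |cubeFourierCoeff
        (fun x : Fin n → Bool => (ArithmeticFunction.moebius (bitsToNat (List.ofFn x)) : ℝ)) S|
      ≤ C * S.card * Real.exp (-(c * Real.sqrt n / S.card))

/-- **Green 2012, Proposition 1 for the Liouville function** (printed remark of §1: "All of the
results in this paper hold equally well for the Liouville function"): for all `n` and nonempty
`S : Finset (Fin n)`, `|λ̂(S)| ≤ C · |S| · exp (-(c · √n / |S|))` with absolute `c > 0`, `C`,
where `λ̂(S) = cubeFourierCoeff (λ ∘ val) S = E_{x < 2^n} λ(x) (-1)^{∑_{i∈S} x_i}`.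
[cite: Green2012, Proposition 1 and §1 remark (Liouville)] -/
def Green2012_liouville_walshCoeff : Prop :=
  ∃ c : ℝ, 0 < c ∧ ∃ C : ℝ, ∀ n : ℕ, ∀ S : Finset (Fin n), 1 ≤ S.card →
    |cubeFourierCoeff
        (fun x : Fin n → Bool => (ArithmeticFunction.liouville (bitsToNat (List.ofFn x)) : ℝ)) S|
      ≤ C * S.card * Real.exp (-(c * Real.sqrt n / S.card))

/-! ### Bourgain 2013 -/

/-- **Bourgain 2013 (J. Anal. Math. 119), Theorem 1** (as printed, for `μ`): "For `λ` large
enough, `max_{A ⊆ {0,…,λ-1}} |∑_{n < 2^λ} μ(n) w_A(n)| < 2^{λ - λ^{1/10}}`", where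
`w_A(x) = ∏_{j∈A} (1 - 2x_j)`, `x = ∑_{0 ≤ j < λ} x_j 2^j` ((0.1), (0.3)). Lean: eventually in
`m` (Bourgain's `λ`), for every `A : Finset (Fin m)`,
`|∑_{N < 2^m} μ(N) · walsh A (j ↦ N.testBit j)| < 2 ^ (m - m^{1/10})` (real exponent).
Answers Kalai's question; uniform over the full Walsh system. [cite: Bourgain2013MoebiusWalsh, Theorem 1] -/
def Bourgain2013_moebius_walsh : Prop :=
  ∀ᶠ m : ℕ in Filter.atTop, ∀ A : Finset (Fin m),
    |∑ N ∈ Finset.range (2 ^ m),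
        (ArithmeticFunction.moebius N : ℝ) * walsh A (fun j : Fin m => Nat.testBit N j)|
      < (2 : ℝ) ^ ((m : ℝ) - (m : ℝ) ^ ((1 : ℝ) / 10))

/-- **Bourgain 2013 (J. Anal. Math. 119), Theorem 1 for the Liouville function** (printed as the
parenthesis after Theorem 1: "(a similar estimate is also valid for the Liouville function)", and
in the abstract: "A similar result also holds for the Liouville function"). Since the printed text
does not pin the saving for `λ`, we record the form the sentence certainly covers, with the
exponent left free: there is `c > 0` such that, for `m` large enough, for every
`A : Finset (Fin m)`, `|∑_{N < 2^m} λ(N) · walsh A (j ↦ N.testBit j)| < 2 ^ (m - m^c)`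
(for `μ` the paper gives `c = 1/10`). Grounds the degree-1 (linear-phase) case of
`Summit.PneNP.PneNP.Theses.Mobius.LiouvilleDigitalPhases` and, up to `<`/`≤`,
`Summit.QuantumAdvantage.QuantumAdvantage.Theses.MobiusLadder.WalshLiouvilleBound`.
[cite: Bourgain2013MoebiusWalsh, Theorem 1 (Liouville remark)] -/
def Bourgain2013_liouville_walsh : Prop :=
  ∃ c : ℝ, 0 < c ∧ ∀ᶠ m : ℕ in Filter.atTop, ∀ A : Finset (Fin m),
    |∑ N ∈ Finset.range (2 ^ m),
        (ArithmeticFunction.liouville N : ℝ) * walsh A (fun j : Fin m => Nat.testBit N j)|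
      < (2 : ℝ) ^ ((m : ℝ) - (m : ℝ) ^ c)

end Literature.Computability.Complexity
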